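import Summits.Schanuel.Schanuel.Theorems.RootDecomp1BMovingZero05

/-!
# RootDecomp1BMovingZero — lens 4, generation 35/36 «AX-TRANSVERSAL MOVING ZERO»: T″ = `IsolatedIntersectionGeneral` PROVED modulo ONE print fact (`CurveSelection`) + the tree Ax statement, and SUB-PIECE A = `AnalyticMovingZero` PROVED modulo TWO print facts (`RoucheMaps`, `IsolatedZeroLowerBound`) — continuation (RootDecomp1BMovingZero06): §E (2/3) two-variable families along a log-line branch, separation of the ρ-frequency, the «λ ∈ ℚ» sub-case

(lens-4 g35 HOME kernels MovingZeroTpp.lean 6bf08f88…de4e (2338 l = §G03 MovingZeroGeneral03 b461aa70… + §E MovingZeroExpPoly fdd5ca6b… + §X MovingZeroAxGerms a74f0949… verbatim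
bodies + NEW §T) and MovingZeroPieceA.lean 8899dedb…8da9 (238 l); ADDENDUM-2 L1857, writer re-check L1858, critic RULING L1859 (T″ VERIFIED and BOOKED; `CurveSelection`
ACCEPTED as THE ONE T-fact), RESULT/DONE L1865, critic RULING/ADDENDUM L1867 (A VERIFIED and BOOKED; `RoucheMaps` / `IsolatedZeroLowerBound` ACCEPTED AS TYPED),
lens-4 g36 NOTE/CLAIM L1871 (PORT-READY) and critic ACK L1875 (PORT STAGING GO; credits T (L1859) and A (L1867) paid at the critic's verification of the
accepted parts carrying `isolatedIntersectionGeneral_of_curveSelection` resp. `analyticMovingZero_of_facts`); port by census-1 gen 17 as `RootDecomp1BMovingZero03`–`10`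
PORT EDITS: the 44 `#guard_msgs in #print axioms` guards and their section headers dropped (HOME probes); `set_option linter.dupNamespace false` dropped; PieceA's
character-identical copy of `AnalyticMovingZero` dropped (§A's definition is used; its Facts + Proof sections follow §A in part 04); the four re-proved
`AxSchanuelTwoGerms` helpers (`exists_algDerivation_eq_derivative'`, `ofPowerSeries_taylor_exp_ne_zero'`, `algebraMap_eq_ofPowerSeries_C'`, `taylor_const'`) PRIVATE in
part 08 (statement-twins of the unbuilt Literature module) with a notation-free private copy `taylor_const''` in part 09; `CurveSelection`'s docstring replaced by the
FACT (T-ii) text dictated in L1871 (ACK L1875); the three fact docstrings' cite KEYS normalised to references.bib (`Chirka1989`, `DAngeloSCV1993` — the gate's cite-key lint), locators unchanged; nine one-line docstrings added; statements and proofs otherwise verbatim; `AxRankBoundLaurent` stays a binder BY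
NAME (discharge: HOME MovingZeroAxGermsTree.lean c3203867… once `AxSchanuelUniv` builds on the farm). `--supports stmt-Schanuel-32406`; no census credit carried;
rung 0 — nothing here proves Schanuel.)
-/

noncomputable section

namespace Summit.Schanuel.Schanuel.Theorems.RootDecomp1BMovingZero

section Epart

open Complex Filter Topology

/-! ### Two-variable polynomial families along a log-line branch `Y = c₀ X^λ` -/

/-- **Monomial expansion engine (general frequencies).** Let `lam, σ ∈ ℂ` be such that the frequency map
`(j, l, k) ↦ j + l·lam + k·σ` is injective on `ℤ³`, and `c₀, c₁ ≠ 0`.  If complex polynomials `g₀, …, g_K ∈ ℂ[X, Y]`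
satisfy `Σ_k g_k(e^{x}, c₀ e^{lam·x}) · c₁^k e^{kσ x} = 0` for all `x` near some `x₀`, then every `g_k = 0`
(each monomial `X^a Y^b` of `g_k` contributes `coeff · c₀^b c₁^k · e^{(a + b·lam + k·σ) x}`; the frequencies are
pairwise distinct by hypothesis; `expPoly_coeff_eq_zero_of_eventually`). -/
theorem mvpoly_family_eq_zero_of_expSum_gen {K : ℕ} {lam σ : ℂ}
    (hinj : Function.Injective (fun p : ℤ × ℤ × ℤ => (p.1 : ℂ) + p.2.1 * lam + p.2.2 * σ))
    {c₀ c₁ : ℂ} (hc₀ : c₀ ≠ 0) (hc₁ : c₁ ≠ 0) (g : Fin (K + 1) → MvPolynomial (Fin 2) ℂ) {x₀ : ℂ}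
    (h : ∀ᶠ x in 𝓝 x₀, ∑ k : Fin (K + 1),
      MvPolynomial.eval ![cexp x, c₀ * cexp (lam * x)] (g k) * (c₁ ^ (k : ℕ) * cexp (((k : ℕ) : ℂ) * σ * x)) = 0) :
    ∀ k, g k = 0 := by
  classical
  set S : Finset (Σ _ : Fin (K + 1), (Fin 2 →₀ ℕ)) := Finset.univ.sigma fun k => (g k).support with hS
  have hμ : Function.Injective (fun q : S =>
      ((q.1.2 0 : ℕ) : ℂ) + ((q.1.2 1 : ℕ) : ℂ) * lam + ((q.1.1 : ℕ) : ℂ) * σ) := by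
    intro a b hab
    simp only at hab
    have h2 := @hinj (((a.1.2 0 : ℕ) : ℤ), ((a.1.2 1 : ℕ) : ℤ), ((a.1.1 : ℕ) : ℤ))
      (((b.1.2 0 : ℕ) : ℤ), ((b.1.2 1 : ℕ) : ℤ), ((b.1.1 : ℕ) : ℤ)) (by push_cast; exact hab)
    simp only [Prod.mk.injEq, Nat.cast_inj] at h2
    obtain ⟨h20, h21, h2k⟩ := h2
    apply Subtype.ext
    have hm : a.1.2 = b.1.2 := by
      ext i
      fin_cases i
      · exact h20
      · exact h21
    exact Sigma.ext (Fin.ext h2k) (heq_of_eq hm)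
  have hexp : ∀ x : ℂ,
      ∑ q : S, (MvPolynomial.coeff q.1.2 (g q.1.1) * c₀ ^ (q.1.2 1) * c₁ ^ (q.1.1 : ℕ)) *
          cexp ((((q.1.2 0 : ℕ) : ℂ) + ((q.1.2 1 : ℕ) : ℂ) * lam + ((q.1.1 : ℕ) : ℂ) * σ) * x)
        = ∑ k : Fin (K + 1),
          MvPolynomial.eval ![cexp x, c₀ * cexp (lam * x)] (g k) * (c₁ ^ (k : ℕ) * cexp (((k : ℕ) : ℂ) * σ * x)) := by
    intro x
    rw [Finset.sum_coe_sort S (fun q : (Σ _ : Fin (K + 1), (Fin 2 →₀ ℕ)) =>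
      (MvPolynomial.coeff q.2 (g q.1) * c₀ ^ (q.2 1) * c₁ ^ (q.1 : ℕ)) *
        cexp ((((q.2 0 : ℕ) : ℂ) + ((q.2 1 : ℕ) : ℂ) * lam + ((q.1 : ℕ) : ℂ) * σ) * x)),
      hS, Finset.sum_sigma]
    refine Finset.sum_congr rfl fun k _ => ?_
    rw [MvPolynomial.eval_eq', Finset.sum_mul]
    refine Finset.sum_congr rfl fun m _ => ?_
    simp only [Fin.prod_univ_two, Matrix.cons_val_zero, Matrix.cons_val_one]
    rw [mul_pow, ← Complex.exp_nat_mul, ← Complex.exp_nat_mul, add_mul, add_mul, Complex.exp_add,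
      Complex.exp_add]
    ring
  have key := expPoly_coeff_eq_zero_of_eventually hμ
    (c := fun q : S => MvPolynomial.coeff q.1.2 (g q.1.1) * c₀ ^ (q.1.2 1) * c₁ ^ (q.1.1 : ℕ)) (x₀ := x₀) (by
    filter_upwards [h] with x hx
    rw [hexp x]
    exact hx)
  intro k
  ext m
  simp only [MvPolynomial.coeff_zero]
  by_contra hne
  have hmem : (⟨k, m⟩ : Σ _ : Fin (K + 1), (Fin 2 →₀ ℕ)) ∈ S := by
    rw [hS, Finset.mem_sigma]
    exact ⟨Finset.mem_univ k, MvPolynomial.mem_support_iff.mpr hne⟩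
  have hq := congr_fun key ⟨⟨k, m⟩, hmem⟩
  simp only [Pi.zero_apply, mul_eq_zero, pow_eq_zero_iff', ne_eq] at hq
  rcases hq with (hq | ⟨hq, -⟩) | ⟨hq, -⟩
  · exact hne hq
  · exact hc₀ hq
  · exact hc₁ hq

/-- **Sub-case «`1, λ, ρ` `ℚ`-free» of T″'s log-line analysis (RULING L1839), polynomial core.** If `1, lam, ρ` are
`ℚ`-linearly independent, `c₀ ≠ 0`, and `g₀, …, g_K ∈ ℂ[X, Y]` satisfy `Σ_k g_k(e^{x}, c₀ e^{lam·x}) e^{kρ x} = 0`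
for all `x` near some `x₀`, then every `g_k = 0`.  In T″: on the log-line branch `Y = c₀ X^λ` with `1, λ, ρ` free,
`F₁|_γ ≡ 0` is the displayed identity for `g_k = G₁ₖ(ρ, ·, ·)`, so every `G₁ₖ(ρ, ·, ·) = 0`, in particular the top
coefficient vanishes at `θ′` — contradicting `GenuineAt`. -/
theorem mvpoly_family_eq_zero_of_expSum {K : ℕ} {lam ρ : ℝ} (h3 : LinearIndependent ℚ ![(1 : ℝ), lam, ρ])
    {c₀ : ℂ} (hc₀ : c₀ ≠ 0) (g : Fin (K + 1) → MvPolynomial (Fin 2) ℂ) {x₀ : ℂ}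
    (h : ∀ᶠ x in 𝓝 x₀, ∑ k : Fin (K + 1),
      MvPolynomial.eval ![cexp x, c₀ * cexp ((lam : ℂ) * x)] (g k) * cexp (((k : ℕ) : ℂ) * (ρ : ℂ) * x) = 0) :
    ∀ k, g k = 0 :=
  mvpoly_family_eq_zero_of_expSum_gen (injective_freq₃' h3) hc₀ one_ne_zero g (x₀ := x₀) (by
    filter_upwards [h] with x hx
    simpa only [one_pow, one_mul] using hx)

/-- Frequencies of the sub-case «`λ = α + βρ`, `β ≠ 0`» of T″ (for the SECOND curve, `Y^ρ = c₁ e^{λρ x}` on the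
branch): if `1, ρ, ρ²` are `ℚ`-linearly independent and `α, β ∈ ℚ`, `β ≠ 0`, then
`(j, l, k) ↦ j + l(α + βρ) + k(α + βρ)ρ = (j + lα) + (lβ + kα)ρ + kβ ρ²` is injective on `ℤ³`
(the `ρ²`-component `kβ` separates `k` BECAUSE `1, ρ, ρ²` are free — critic (T-i)/(s-iv)). -/
theorem injective_freq_quadratic {ρ : ℝ} (h3 : LinearIndependent ℚ ![(1 : ℝ), ρ, ρ ^ 2]) {α β : ℚ} (hβ : β ≠ 0) :
    Function.Injective
      (fun p : ℤ × ℤ × ℤ => (p.1 : ℝ) + p.2.1 * ((α : ℝ) + β * ρ) + p.2.2 * (((α : ℝ) + β * ρ) * ρ)) := by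
  intro p q hpq
  simp only at hpq
  have hli := Fintype.linearIndependent_iff.mp h3
    (![((p.1 - q.1 : ℤ) : ℚ) + ((p.2.1 - q.2.1 : ℤ) : ℚ) * α,
       ((p.2.1 - q.2.1 : ℤ) : ℚ) * β + ((p.2.2 - q.2.2 : ℤ) : ℚ) * α,
       ((p.2.2 - q.2.2 : ℤ) : ℚ) * β]) (by
      simp only [Fin.sum_univ_three, Matrix.cons_val_zero, Matrix.cons_val_one, Matrix.cons_val]
      simp only [Rat.smul_def]
      push_cast
      linear_combination hpq)
  have h0 := hli 0
  have h1 := hli 1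
  have h2 := hli 2
  simp only [Matrix.cons_val_zero, Matrix.cons_val_one, Matrix.cons_val] at h0 h1 h2
  have hk : p.2.2 = q.2.2 := by
    rcases mul_eq_zero.mp h2 with h | h
    · exact sub_eq_zero.mp (by exact_mod_cast h)
    · exact absurd h hβ
  have hl : p.2.1 = q.2.1 := by
    have hk' : ((p.2.2 - q.2.2 : ℤ) : ℚ) = 0 := by rw [hk, sub_self, Int.cast_zero]
    rw [hk', zero_mul, add_zero] at h1
    rcases mul_eq_zero.mp h1 with h | h
    · exact sub_eq_zero.mp (by exact_mod_cast h)
    · exact absurd h hβ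
  have hj : p.1 = q.1 := by
    have hl' : ((p.2.1 - q.2.1 : ℤ) : ℚ) = 0 := by rw [hl, sub_self, Int.cast_zero]
    rw [hl', zero_mul, add_zero] at h0
    exact sub_eq_zero.mp (by exact_mod_cast h0)
  exact Prod.ext hj (Prod.ext hl hk)

/-- The same frequencies read in `ℂ`. -/
theorem injective_freq_quadratic' {ρ : ℝ} (h3 : LinearIndependent ℚ ![(1 : ℝ), ρ, ρ ^ 2]) {α β : ℚ}
    (hβ : β ≠ 0) :
    Function.Injective (fun p : ℤ × ℤ × ℤ =>
      (p.1 : ℂ) + p.2.1 * (((α : ℝ) + β * ρ : ℝ) : ℂ) + p.2.2 * ((((α : ℝ) + β * ρ) * ρ : ℝ) : ℂ)) := by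
  have : (fun p : ℤ × ℤ × ℤ =>
      (p.1 : ℂ) + p.2.1 * (((α : ℝ) + β * ρ : ℝ) : ℂ) + p.2.2 * ((((α : ℝ) + β * ρ) * ρ : ℝ) : ℂ)) =
      (fun r : ℝ => (r : ℂ)) ∘
        (fun p : ℤ × ℤ × ℤ => (p.1 : ℝ) + p.2.1 * ((α : ℝ) + β * ρ) + p.2.2 * (((α : ℝ) + β * ρ) * ρ)) := by
    funext p
    simp only [Function.comp_apply]
    push_cast
    ring
  rw [this]
  exact Complex.ofReal_injective.comp (injective_freq_quadratic h3 hβ)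

/-- **Sub-case «`λ = α + βρ`, `β ≠ 0`, `1, ρ, ρ²` free» of T″ (RULING L1839), polynomial core** — the second
curve along the branch `Y = c₀ X^λ`, where `Y^ρ = c₁ e^{λρ·x}` (`c₁ = e^{ρ Log c₀ + 2πiνρ} ≠ 0`): if
`Σ_k g_k(e^{x}, c₀ e^{λ x}) c₁^k e^{kλρ x} = 0` near `x₀` then every `g_k = 0` (so the top coefficient
`G₂K₂(ρ, ·, ·)` vanishes at `θ′` — contradicting `GenuineAt`). -/
theorem mvpoly_family_eq_zero_of_expSum_quadratic {K : ℕ} {ρ : ℝ}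
    (h3 : LinearIndependent ℚ ![(1 : ℝ), ρ, ρ ^ 2]) {α β : ℚ} (hβ : β ≠ 0)
    {c₀ c₁ : ℂ} (hc₀ : c₀ ≠ 0) (hc₁ : c₁ ≠ 0) (g : Fin (K + 1) → MvPolynomial (Fin 2) ℂ) {x₀ : ℂ}
    (h : ∀ᶠ x in 𝓝 x₀, ∑ k : Fin (K + 1),
      MvPolynomial.eval ![cexp x, c₀ * cexp ((((α : ℝ) + β * ρ : ℝ) : ℂ) * x)] (g k) *
        (c₁ ^ (k : ℕ) * cexp (((k : ℕ) : ℂ) * ((((α : ℝ) + β * ρ) * ρ : ℝ) : ℂ) * x)) = 0) :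
    ∀ k, g k = 0 :=
  mvpoly_family_eq_zero_of_expSum_gen (injective_freq_quadratic' h3 hβ) hc₀ hc₁ g (x₀ := x₀) h

/-! ### Separation of the `ρ`-frequency (the sub-case «`λ ∈ ℚ`» of T″): abstract form -/

open Classical in
/-- **Synthesis (converse of grouping).** If every fiber sum of the coefficients vanishes then the exponential sum
vanishes identically. -/
theorem expSum_eq_zero_of_fiber_sums {ι : Type*} [Fintype ι] (ν c : ι → ℂ)
    (hfib : ∀ φ : ℂ, ∑ i ∈ Finset.univ.filter (fun i => ν i = φ), c i = 0) (x : ℂ) :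
    ∑ i, c i * cexp (ν i * x) = 0 := by
  rw [← Finset.sum_fiberwise_of_maps_to (s := Finset.univ) (t := Finset.univ.image ν) (g := ν)
    (fun i hi => Finset.mem_image_of_mem ν hi)]
  refine Finset.sum_eq_zero fun φ _ => ?_
  have hφ : ∑ i ∈ Finset.univ.filter (fun i => ν i = φ), c i * cexp (ν i * x)
      = cexp (φ * x) * ∑ i ∈ Finset.univ.filter (fun i => ν i = φ), c i := by
    rw [Finset.mul_sum]
    refine Finset.sum_congr rfl fun i hi => ?_
    rw [Finset.mem_filter] at hi
    rw [hi.2]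
    ring
  rw [hφ, hfib φ, mul_zero]

/-- For IRRATIONAL real `ρ` the map `(a, b) ↦ a + bρ` is injective on `ℚ × ℚ` (so a frequency `ν + kρ` with `ν`
rational determines `k`). -/
theorem injective_rat_add_rat_mul {ρ : ℝ} (hρ : Irrational ρ) :
    Function.Injective (fun p : ℚ × ℚ => (p.1 : ℝ) + p.2 * ρ) := by
  intro p q h
  simp only at h
  by_cases hk : p.2 = q.2
  · have h1 : (p.1 : ℝ) = q.1 := by rw [hk] at h; linarith
    exact Prod.ext (by exact_mod_cast h1) hk
  · exfalso
    have hne : (p.2 : ℝ) - q.2 ≠ 0 := by exact_mod_cast sub_ne_zero.mpr hk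
    have hρeq : ρ = ((q.1 : ℝ) - p.1) / ((p.2 : ℝ) - q.2) := by
      field_simp
      linarith
    exact hρ ⟨(q.1 - p.1) / (p.2 - q.2), by rw [hρeq]; push_cast; ring⟩

open Classical in
/-- **Separation lemma.** Frequencies of the shape `νᵢ + kᵢ σ` where the pair is determined by the sum as far as `kᵢ`
goes (`hsep`; e.g. `νᵢ ∈ ℚ`, `kᵢ ∈ ℤ`, `σ = ρ` irrational, by `injective_rat_add_rat_mul`): if
`Σᵢ cᵢ e^{(νᵢ + kᵢσ) x} = 0` near `x₀` then for every `k` and `φ` the coefficients with `kᵢ = k`, `νᵢ = φ` sum to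
zero — hence (by `expSum_eq_zero_of_fiber_sums` on the sub-family `kᵢ = k`) each slice `Σ_{kᵢ = k} cᵢ e^{νᵢ x}`
vanishes IDENTICALLY.  In T″ (log-line branch `Y = c₀ X^λ`, `λ ∈ ℚ`): the slice `k = K₁` is
`G₁K₁(ρ, X, c₀ X^λ)|_γ ≡ 0`, so the top coefficient vanishes at `θ′ ∈ γ` — contradicting `GenuineAt`. -/
theorem fiber_sum_separate {ι : Type*} [Fintype ι] (ν c : ι → ℂ) (kk : ι → ℤ) (σ : ℂ) {x₀ : ℂ}
    (hsep : ∀ i j, ν i + kk i * σ = ν j + kk j * σ → kk i = kk j)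
    (h : ∀ᶠ x in 𝓝 x₀, ∑ i, c i * cexp ((ν i + kk i * σ) * x) = 0) (k : ℤ) (φ : ℂ) :
    ∑ i ∈ Finset.univ.filter (fun i => kk i = k ∧ ν i = φ), c i = 0 := by
  by_cases hne : (Finset.univ.filter (fun i => kk i = k ∧ ν i = φ)).Nonempty
  · obtain ⟨i₀, hi₀⟩ := hne
    rw [Finset.mem_filter] at hi₀
    have hset : Finset.univ.filter (fun i => kk i = k ∧ ν i = φ)
        = Finset.univ.filter (fun i => ν i + kk i * σ = ν i₀ + kk i₀ * σ) := by
      ext i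
      simp only [Finset.mem_filter, Finset.mem_univ, true_and]
      constructor
      · rintro ⟨hk, hν⟩
        rw [hk, hν, hi₀.2.1, hi₀.2.2]
      · intro hμ
        have hk : kk i = kk i₀ := hsep i i₀ hμ
        refine ⟨hk.trans hi₀.2.1, ?_⟩
        rw [hk] at hμ
        have hν : ν i = ν i₀ := add_right_cancel hμ
        rw [hν, hi₀.2.2]
    rw [hset]
    exact expPoly_fiber_sum_eq_zero (fun i => ν i + kk i * σ) c h _
  · rw [Finset.not_nonempty_iff_eq_empty] at hne
    rw [hne, Finset.sum_empty]

open Classical in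
/-- **Slices vanish identically.** Under the separation hypothesis, each slice `Σ_{i : kᵢ = k} cᵢ e^{νᵢ x}` of an
exponential sum vanishing near `x₀` vanishes for EVERY `x ∈ ℂ`. -/
theorem slice_eq_zero_of_expSum {ι : Type*} [Fintype ι] (ν c : ι → ℂ) (kk : ι → ℤ) (σ : ℂ) {x₀ : ℂ}
    (hsep : ∀ i j, ν i + kk i * σ = ν j + kk j * σ → kk i = kk j)
    (h : ∀ᶠ x in 𝓝 x₀, ∑ i, c i * cexp ((ν i + kk i * σ) * x) = 0) (k : ℤ) (x : ℂ) :
    ∑ i ∈ Finset.univ.filter (fun i => kk i = k), c i * cexp (ν i * x) = 0 := by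
  set T := Finset.univ.filter (fun i => kk i = k) with hT
  rw [← Finset.sum_fiberwise_of_maps_to (s := T) (t := T.image ν) (g := ν)
    (fun i hi => Finset.mem_image_of_mem ν hi)]
  refine Finset.sum_eq_zero fun φ _ => ?_
  have hTT : T.filter (fun i => ν i = φ) = Finset.univ.filter (fun i => kk i = k ∧ ν i = φ) := by
    rw [hT, Finset.filter_filter]
  have hφ : ∑ i ∈ T.filter (fun i => ν i = φ), c i * cexp (ν i * x)
      = cexp (φ * x) * ∑ i ∈ T.filter (fun i => ν i = φ), c i := by
    rw [Finset.mul_sum]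
    refine Finset.sum_congr rfl fun i hi => ?_
    rw [Finset.mem_filter] at hi
    rw [hi.2]
    ring
  rw [hφ, hTT, fiber_sum_separate ν c kk σ hsep h k φ, mul_zero]

/-! ### The log-line sub-case «`λ ∈ ℚ`» of T″, at the polynomial level -/

/-- **Sub-case «`λ = r ∈ ℚ`» of T″'s log-line analysis (RULING L1839), polynomial core.** For IRRATIONAL real `ρ`,
rational `r`, `c₀ ≠ 0` and `g₀, …, g_K ∈ ℂ[X, Y]`: if `Σ_k g_k(e^{x}, c₀ e^{r x}) e^{kρ x} = 0` for all `x` near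
some `x₀`, then EACH slice vanishes identically: `g_k(e^{x}, c₀ e^{r x}) = 0` for every `k` and every `x ∈ ℂ`
(the monomial frequencies are `(a + b r) + kρ` with `a + b r ∈ ℚ`, so the `ρ`-frequency `k` separates:
`slice_eq_zero_of_expSum` with `injective_rat_add_rat_mul`).  In T″: the slice `k = K₁` at `x = Log X₀` says the
top coefficient `G₁K₁(ρ, X₀, Y₀) = 0` — contradicting `GenuineAt`.  (The polynomials `g_k` themselves need
not vanish: `g = (Y − c₀ X^r)`-multiples do, for `r ∈ ℕ`.) -/
theorem mvpoly_slice_eq_zero_of_expSum_rat {K : ℕ} {ρ : ℝ} (hρ : Irrational ρ) (r : ℚ) {c₀ : ℂ}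
    (g : Fin (K + 1) → MvPolynomial (Fin 2) ℂ) {x₀ : ℂ}
    (h : ∀ᶠ x in 𝓝 x₀, ∑ k : Fin (K + 1),
      MvPolynomial.eval ![cexp x, c₀ * cexp (((r : ℝ) : ℂ) * x)] (g k) * cexp (((k : ℕ) : ℂ) * (ρ : ℂ) * x) = 0)
    (k : Fin (K + 1)) (x : ℂ) :
    MvPolynomial.eval ![cexp x, c₀ * cexp (((r : ℝ) : ℂ) * x)] (g k) = 0 := by
  classical
  set S : Finset (Σ _ : Fin (K + 1), (Fin 2 →₀ ℕ)) := Finset.univ.sigma fun k => (g k).support with hS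
  -- frequencies ν + kk·ρ, coefficients
  have hsep : ∀ i j : S,
      (((i.1.2 0 : ℕ) : ℂ) + ((i.1.2 1 : ℕ) : ℂ) * ((r : ℝ) : ℂ)) + ((((i.1.1 : ℕ) : ℤ)) : ℂ) * (ρ : ℂ)
        = (((j.1.2 0 : ℕ) : ℂ) + ((j.1.2 1 : ℕ) : ℂ) * ((r : ℝ) : ℂ)) + ((((j.1.1 : ℕ) : ℤ)) : ℂ) * (ρ : ℂ) →
      (((i.1.1 : ℕ) : ℤ)) = (((j.1.1 : ℕ) : ℤ)) := by
    intro i j hij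
    have hreal : (((i.1.2 0 : ℕ) : ℚ) + ((i.1.2 1 : ℕ) : ℚ) * r : ℚ) + (((i.1.1 : ℕ) : ℚ) : ℝ) * ρ
        = ((((j.1.2 0 : ℕ) : ℚ) + ((j.1.2 1 : ℕ) : ℚ) * r : ℚ) : ℝ) + (((j.1.1 : ℕ) : ℚ) : ℝ) * ρ := by
      apply Complex.ofReal_injective
      push_cast at hij ⊢
      exact hij
    have h2 := injective_rat_add_rat_mul hρ (a₁ := (((i.1.2 0 : ℕ) : ℚ) + ((i.1.2 1 : ℕ) : ℚ) * r, ((i.1.1 : ℕ) : ℚ)))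
      (a₂ := (((j.1.2 0 : ℕ) : ℚ) + ((j.1.2 1 : ℕ) : ℚ) * r, ((j.1.1 : ℕ) : ℚ))) (by simpa using hreal)
    simp only [Prod.mk.injEq, Nat.cast_inj] at h2
    exact_mod_cast h2.2
  have hexp : ∀ y : ℂ,
      ∑ q : S, (MvPolynomial.coeff q.1.2 (g q.1.1) * c₀ ^ (q.1.2 1)) *
          cexp (((((q.1.2 0 : ℕ) : ℂ) + ((q.1.2 1 : ℕ) : ℂ) * ((r : ℝ) : ℂ)) + ((((q.1.1 : ℕ) : ℤ)) : ℂ) * (ρ : ℂ)) * y)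
        = ∑ k : Fin (K + 1),
          MvPolynomial.eval ![cexp y, c₀ * cexp (((r : ℝ) : ℂ) * y)] (g k) * cexp (((k : ℕ) : ℂ) * (ρ : ℂ) * y) := by
    intro y
    rw [Finset.sum_coe_sort S (fun q : (Σ _ : Fin (K + 1), (Fin 2 →₀ ℕ)) =>
      (MvPolynomial.coeff q.2 (g q.1) * c₀ ^ (q.2 1)) *
        cexp (((((q.2 0 : ℕ) : ℂ) + ((q.2 1 : ℕ) : ℂ) * ((r : ℝ) : ℂ)) + ((((q.1 : ℕ) : ℤ)) : ℂ) * (ρ : ℂ)) * y)),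
      hS, Finset.sum_sigma]
    refine Finset.sum_congr rfl fun k _ => ?_
    rw [MvPolynomial.eval_eq', Finset.sum_mul]
    refine Finset.sum_congr rfl fun m _ => ?_
    simp only [Fin.prod_univ_two, Matrix.cons_val_zero, Matrix.cons_val_one]
    rw [mul_pow, ← Complex.exp_nat_mul, ← Complex.exp_nat_mul, add_mul, add_mul, Complex.exp_add,
      Complex.exp_add]
    push_cast
    ring
  have h' : ∀ᶠ y in 𝓝 x₀,
      ∑ q : S, (MvPolynomial.coeff q.1.2 (g q.1.1) * c₀ ^ (q.1.2 1)) *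
          cexp (((((q.1.2 0 : ℕ) : ℂ) + ((q.1.2 1 : ℕ) : ℂ) * ((r : ℝ) : ℂ)) + ((((q.1.1 : ℕ) : ℤ)) : ℂ) * (ρ : ℂ)) * y)
        = 0 := by
    filter_upwards [h] with y hy
    rw [hexp y]
    exact hy
  have hslice := slice_eq_zero_of_expSum
    (fun q : S => ((q.1.2 0 : ℕ) : ℂ) + ((q.1.2 1 : ℕ) : ℂ) * ((r : ℝ) : ℂ))
    (fun q : S => MvPolynomial.coeff q.1.2 (g q.1.1) * c₀ ^ (q.1.2 1))
    (fun q : S => ((q.1.1 : ℕ) : ℤ)) (ρ : ℂ) hsep h' ((k : ℕ) : ℤ) x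
  -- identify the slice with the evaluation of `g k`
  rw [Finset.sum_filter] at hslice
  have hcoe := Finset.sum_coe_sort S (fun q : (Σ _ : Fin (K + 1), (Fin 2 →₀ ℕ)) =>
    if ((q.1 : ℕ) : ℤ) = ((k : ℕ) : ℤ) then
      (MvPolynomial.coeff q.2 (g q.1) * c₀ ^ (q.2 1)) *
        cexp ((((q.2 0 : ℕ) : ℂ) + ((q.2 1 : ℕ) : ℂ) * ((r : ℝ) : ℂ)) * x)
    else 0)
  rw [hcoe, ← Finset.sum_filter] at hslice
  have hfilt : S.filter (fun q => ((q.1 : ℕ) : ℤ) = ((k : ℕ) : ℤ))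
      = ({k} : Finset (Fin (K + 1))).sigma (fun k => (g k).support) := by
    ext q
    simp only [hS, Finset.mem_filter, Finset.mem_sigma, Finset.mem_univ, true_and, Finset.mem_singleton,
      Nat.cast_inj, Fin.val_inj]
    constructor
    · rintro ⟨a, b⟩; exact ⟨b, a⟩
    · rintro ⟨a, b⟩; exact ⟨b, a⟩
  rw [hfilt, Finset.sum_sigma, Finset.sum_singleton] at hslice
  rw [MvPolynomial.eval_eq', ← hslice]
  refine Finset.sum_congr rfl fun m _ => ?_
  simp only [Fin.prod_univ_two, Matrix.cons_val_zero, Matrix.cons_val_one]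
  rw [mul_pow, ← Complex.exp_nat_mul, ← Complex.exp_nat_mul, add_mul, Complex.exp_add]
  ring

end Epart

end Summit.Schanuel.Schanuel.Theorems.RootDecomp1BMovingZero

end
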